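import Literature.Analysis.FluidPDE.KinematicApexWitness
import Literature.Analysis.FluidPDE.NewtonPotentialHolder
import HarnessLib

/-!
# Route SqueezeCycle · item `NoApexTypeIProfile` (stmt-NavierStokesRegularity-11716):
# scale-invariant envelopes imply Albritton–Barker's `𝐈 < ∞` — part 1, pointwise and radial tools

Helper file (theorems only; no definitions, no named facts), `--supports` the item.

Write `w(t,x) = ‖x‖ + √(−t)` for the parabolic distance to the space–time origin.  An apex Type-I
profile and its Riesz pressure obey the SCALE-INVARIANT ENVELOPES `‖V‖ ≤ C/w` (KNSS 2009 (1.6),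
`HasTypeIDecay C V`), `‖∇V‖ ≤ L/w²`, `|Q| ≤ L/w²` (Seregin–Šverák 2009 §2; the tree's
`ScaleInvariantBounds`).  This file provides the elementary tools that turn such envelopes into bounds
for Albritton–Barker's scaled quantities `A, C, D, E` (assembled in part 2,
`SqueezeCycleNoApexTypeIProfileEnvelopeTypeIBound.lean`):

* `lintegral_ball_norm_rpow_neg_le`: `∫_{B(x₀,r)} ‖x‖^{−σ} dx ≤ M_σ r^{3−σ}` for EVERY centre `x₀`
  (`0 ≤ σ < 3`; near the origin by the radial integral over `B(0,3r)`, far from it by `‖x‖ > r`),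
  packaged at `σ = 2` and `σ = 5/2` (`exists_ball_rpow_two_bound`, `exists_ball_rpow_fiveHalves_bound`);
* `lintegral_time_rpow_neg_le`: `∫_{t'−ρ²}^{t'} (−s)^{−β} ds ≤ ρ^{2(1−β)}/(1−β)` for `t' ≤ 0`,
  `0 ≤ β < 1`;
* the pointwise splittings `w⁻² ≤ ‖x‖⁻²`, `w⁻³ ≤ ‖x‖⁻² (−t)^{−1/2}`, `w⁻⁴ ≤ ‖x‖^{−5/2} (−t)^{−3/4}`
  applied to `|V|²`, `|V|³`, `|Q|^{3/2}` and `|G|²_F ≤ 3‖G‖²` (`enorm_sq_le_of_envelope`,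
  `enorm_cube_le_of_envelope`, `enorm_rpow_le_of_envelope`, `ofReal_frob_le_of_envelope`).

## References

* D. Albritton, T. Barker, *On local Type I singularities of the Navier–Stokes equations and
  Liouville theorems*, J. Math. Fluid Mech. 21 (2019) = arXiv:1811.00502, §1. [AlbrittonBarker2019]
* G. Koch, N. Nadirashvili, G. Seregin, V. Šverák, Acta Math. 203 (2009), (1.6). [KNSS2009]
* G. Seregin, V. Šverák, Comm. PDE 34 (2009) = arXiv:0804.1803, §2. [SereginSverak2009]
-/

noncomputable section

-- the sub-problem namespace repeats the summit name (D-0017 layout `Summit.<S>.<P>.Theorems`)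
set_option linter.dupNamespace false

namespace Summit.NavierStokesRegularity.NavierStokesRegularity.Theorems.NoApexEnvelope

open MeasureTheory Set Function Filter Metric TopologicalSpace
open scoped ENNReal NNReal Topology
open Literature.Analysis.FluidPDE
open Literature.Analysis.FluidPDE.ParabolicBump (volume_ball_three frobeniusNormSq_le_three_mul_norm_sq')

/-! ### Radial power integrals over balls with arbitrary centre -/

/-- The constant `M_σ = 3|B₁| 3^{3−σ}/(3−σ) + |B₁|` of `lintegral_ball_norm_rpow_neg_le`. [folklore] -/
theorem ballConst_nonneg {σ : ℝ} (hσ : σ < 3) :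
    0 ≤ 3 * (volume : Measure (EuclideanSpace ℝ (Fin 3))).real (ball 0 1) * (3 ^ (3 - σ) / (3 - σ)) +
      (volume : Measure (EuclideanSpace ℝ (Fin 3))).real (ball 0 1) := by
  have h3 : 0 < 3 - σ := by linarith
  positivity

/-- **`∫_{B(x₀,r)} ‖x‖^{−σ} dx ≤ M_σ r^{3−σ}` for every centre `x₀`** (`0 ≤ σ < 3`): if
`‖x₀‖ ≤ 2r` the ball lies in `B(0,3r)` (radial integral `lintegral_ball_norm_rpow_neg`); otherwise
`‖x‖ > r` on the ball and the integrand is at most `r^{−σ}`. [folklore] -/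
theorem lintegral_ball_norm_rpow_neg_le {σ : ℝ} (hσ0 : 0 ≤ σ) (hσ : σ < 3) (x₀ : (EuclideanSpace ℝ (Fin 3))) {r : ℝ}
    (hr : 0 < r) :
    ∫⁻ x in ball x₀ r, ENNReal.ofReal (‖x‖ ^ (-σ)) ≤
      ENNReal.ofReal ((3 * (volume : Measure (EuclideanSpace ℝ (Fin 3))).real (ball 0 1) * (3 ^ (3 - σ) / (3 - σ)) +
        (volume : Measure (EuclideanSpace ℝ (Fin 3))).real (ball 0 1)) * r ^ (3 - σ)) := by
  set V₁ : ℝ := (volume : Measure (EuclideanSpace ℝ (Fin 3))).real (ball 0 1) with hV₁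
  have hV₁0 : 0 ≤ V₁ := measureReal_nonneg
  have h3σ : 0 < 3 - σ := by linarith
  have hrpow : 0 ≤ r ^ (3 - σ) := Real.rpow_nonneg hr.le _
  rcases le_or_gt ‖x₀‖ (2 * r) with hx₀ | hx₀
  · -- near the origin: `B(x₀, r) ⊆ B(0, 3r)`
    have hsub : ball x₀ r ⊆ ball (0 : (EuclideanSpace ℝ (Fin 3))) (3 * r) := by
      intro x hx
      rw [mem_ball, dist_eq_norm] at hx
      rw [mem_ball_zero_iff]
      calc ‖x‖ = ‖(x - x₀) + x₀‖ := by rw [sub_add_cancel]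
        _ ≤ ‖x - x₀‖ + ‖x₀‖ := norm_add_le _ _
        _ < r + 2 * r := add_lt_add_of_lt_of_le hx hx₀
        _ = 3 * r := by ring
    calc ∫⁻ x in ball x₀ r, ENNReal.ofReal (‖x‖ ^ (-σ))
        ≤ ∫⁻ x in ball (0 : (EuclideanSpace ℝ (Fin 3))) (3 * r), ENNReal.ofReal (‖x‖ ^ (-σ)) := lintegral_mono_set hsub
      _ = ENNReal.ofReal (3 * V₁ * ((3 * r) ^ (3 - σ) / (3 - σ))) :=
          NewtonPotentialHolder.lintegral_ball_norm_rpow_neg hσ (by positivity)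
      _ ≤ _ := by
          refine ENNReal.ofReal_le_ofReal ?_
          rw [Real.mul_rpow (by norm_num) hr.le, add_mul]
          have h2 : 0 ≤ V₁ * r ^ (3 - σ) := mul_nonneg hV₁0 hrpow
          calc 3 * V₁ * (3 ^ (3 - σ) * r ^ (3 - σ) / (3 - σ))
              = 3 * V₁ * (3 ^ (3 - σ) / (3 - σ)) * r ^ (3 - σ) := by ring
            _ ≤ 3 * V₁ * (3 ^ (3 - σ) / (3 - σ)) * r ^ (3 - σ) + V₁ * r ^ (3 - σ) :=
                le_add_of_nonneg_right h2
  · -- far from the origin: `‖x‖ > r` on the ball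
    have hpt : ∀ x ∈ ball x₀ r, ENNReal.ofReal (‖x‖ ^ (-σ)) ≤ ENNReal.ofReal (r ^ (-σ)) := by
      intro x hx
      rw [mem_ball, dist_eq_norm] at hx
      have hxr : r ≤ ‖x‖ := by
        have h1 : ‖x₀‖ ≤ ‖x‖ + ‖x - x₀‖ := by
          calc ‖x₀‖ = ‖x - (x - x₀)‖ := by rw [sub_sub_cancel]
            _ ≤ ‖x‖ + ‖x - x₀‖ := norm_sub_le _ _
        linarith
      exact ENNReal.ofReal_le_ofReal (Real.rpow_le_rpow_of_nonpos hr hxr (by linarith))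
    calc ∫⁻ x in ball x₀ r, ENNReal.ofReal (‖x‖ ^ (-σ))
        ≤ ∫⁻ _ in ball x₀ r, ENNReal.ofReal (r ^ (-σ)) :=
          setLIntegral_mono measurable_const hpt
      _ = ENNReal.ofReal (r ^ (-σ)) * volume (ball x₀ r) := setLIntegral_const _ _
      _ = ENNReal.ofReal (r ^ (-σ)) * (ENNReal.ofReal (r ^ 3) * ENNReal.ofReal V₁) := by
          rw [volume_ball_three x₀ hr, hV₁, ofReal_measureReal measure_ball_lt_top.ne]
      _ = ENNReal.ofReal (V₁ * r ^ (3 - σ)) := by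
          rw [← mul_assoc, ← ENNReal.ofReal_mul (Real.rpow_nonneg hr.le _),
            ← ENNReal.ofReal_mul (by positivity)]
          congr 1
          have h3 : r ^ (3 : ℝ) = r ^ (3 : ℕ) := by exact_mod_cast Real.rpow_natCast r 3
          rw [show (3 : ℝ) - σ = -σ + 3 by ring, Real.rpow_add hr, h3]
          ring
      _ ≤ _ := by
          refine ENNReal.ofReal_le_ofReal ?_
          rw [add_mul]
          have h1 : 0 ≤ 3 * V₁ * (3 ^ (3 - σ) / (3 - σ)) * r ^ (3 - σ) := by positivity
          linarith

/-! ### Singular time integrals below the final time -/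

/-- **`∫_{t'−ρ²}^{t'} (−s)^{−β} ds ≤ ρ^{2(1−β)}/(1−β)`** for `t' ≤ 0`, `0 ≤ β < 1` (worst case
`t' = 0`; subadditivity of `y ↦ y^{1−β}`). [folklore] -/
theorem lintegral_time_rpow_neg_le {β : ℝ} (hβ0 : 0 ≤ β) (hβ : β < 1) {t' ρ : ℝ} (ht : t' ≤ 0)
    (hρ : 0 < ρ) :
    ∫⁻ s in Ioo (t' - ρ ^ 2) t', ENNReal.ofReal ((-s) ^ (-β)) ≤
      ENNReal.ofReal (ρ ^ (2 * (1 - β)) / (1 - β)) := by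
  have hab : t' - ρ ^ 2 ≤ t' := by nlinarith
  have h1β : 0 < 1 - β := by linarith
  have hint : IntegrableOn (fun s => (0 - s) ^ (-β)) (Ioo (t' - ρ ^ 2) t') volume := by
    have h1 : IntervalIntegrable (fun x : ℝ => x ^ (-β)) volume (0 - (t' - ρ ^ 2)) (0 - t') :=
      intervalIntegral.intervalIntegrable_rpow' (by linarith)
    have h2 := h1.comp_sub_left 0
    simp only [sub_sub_cancel] at h2
    exact ((intervalIntegrable_iff_integrableOn_Ioc_of_le hab).1 h2).mono_set Ioo_subset_Ioc_self
  have hnn : 0 ≤ᵐ[volume.restrict (Ioo (t' - ρ ^ 2) t')] fun s => (0 - s) ^ (-β) := by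
    filter_upwards [ae_restrict_mem measurableSet_Ioo] with s hs
    exact Real.rpow_nonneg (by linarith [hs.2]) _
  have e0 : (fun s : ℝ => ENNReal.ofReal ((-s) ^ (-β))) = fun s => ENNReal.ofReal ((0 - s) ^ (-β)) := by
    funext s; rw [zero_sub]
  rw [e0, ← ofReal_integral_eq_lintegral_ofReal hint hnn]
  refine ENNReal.ofReal_le_ofReal ?_
  have heval : ∫ s in Ioo (t' - ρ ^ 2) t', (0 - s) ^ (-β) =
      ((0 - t' + ρ ^ 2) ^ (-β + 1) - (0 - t') ^ (-β + 1)) / (-β + 1) := by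
    rw [← integral_Ioc_eq_integral_Ioo, ← intervalIntegral.integral_of_le hab,
      intervalIntegral.integral_comp_sub_left (fun x : ℝ => x ^ (-β)) 0,
      integral_rpow (Or.inl (by linarith))]
    congr 1
    rw [show (0 : ℝ) - (t' - ρ ^ 2) = 0 - t' + ρ ^ 2 by ring]
  rw [heval]
  have hα : 0 ≤ 0 - t' := by linarith
  have hexp : -β + 1 = 1 - β := by ring
  rw [hexp]
  have hsub : (0 - t' + ρ ^ 2) ^ (1 - β) ≤ (0 - t') ^ (1 - β) + (ρ ^ 2) ^ (1 - β) :=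
    Real.rpow_add_le_add_rpow hα (by positivity) h1β.le (by linarith)
  have hρ2 : (ρ ^ 2) ^ (1 - β) = ρ ^ (2 * (1 - β)) := by
    rw [show ρ ^ 2 = ρ ^ (2 : ℝ) by norm_cast, ← Real.rpow_mul hρ.le]
  rw [div_le_div_iff_of_pos_right h1β, ← hρ2]
  linarith

/-! ### Pointwise envelope algebra -/

/-- **Splitting a parabolic weight**: if `0 < a ≤ w` and `0 < b ≤ w` then
`K / w^{p+q} ≤ K · a^{−p} · b^{−q}` (`p, q, K ≥ 0`). Used with `a = ‖x‖`, `b = √(−t)`,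
`w = ‖x‖ + √(−t)`. [folklore] -/
theorem div_rpow_add_le {a b w K p q : ℝ} (ha : 0 < a) (hb : 0 < b) (haw : a ≤ w) (hbw : b ≤ w)
    (hp : 0 ≤ p) (hq : 0 ≤ q) (hK : 0 ≤ K) :
    K / w ^ (p + q) ≤ K * a ^ (-p) * b ^ (-q) := by
  have hw : 0 < w := ha.trans_le haw
  have hprod : a ^ p * b ^ q ≤ w ^ (p + q) := by
    rw [Real.rpow_add hw]
    exact mul_le_mul (Real.rpow_le_rpow ha.le haw hp) (Real.rpow_le_rpow hb.le hbw hq)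
      (Real.rpow_nonneg hb.le _) (Real.rpow_nonneg hw.le _)
  have hpos : 0 < a ^ p * b ^ q := mul_pos (Real.rpow_pos_of_pos ha _) (Real.rpow_pos_of_pos hb _)
  calc K / w ^ (p + q) ≤ K / (a ^ p * b ^ q) := div_le_div_of_nonneg_left hK hpos hprod
    _ = K * a ^ (-p) * b ^ (-q) := by
        rw [Real.rpow_neg ha.le, Real.rpow_neg hb.le, div_eq_mul_inv, mul_inv]
        ring

/-- `√(−t)^{−q} = (−t)^{−q/2}` for `t < 0`. [folklore] -/
theorem sqrt_neg_rpow_neg {t : ℝ} (ht : t < 0) (q : ℝ) :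
    Real.sqrt (-t) ^ (-q) = (-t) ^ (-(q / 2)) := by
  rw [Real.sqrt_eq_rpow, ← Real.rpow_mul (by linarith)]
  congr 1
  ring

variable {V : ℝ → (EuclideanSpace ℝ (Fin 3)) → (EuclideanSpace ℝ (Fin 3))} {Q : ℝ → (EuclideanSpace ℝ (Fin 3)) → ℝ} {G : ℝ → (EuclideanSpace ℝ (Fin 3)) → (EuclideanSpace ℝ (Fin 3)) →L[ℝ] (EuclideanSpace ℝ (Fin 3))} {C L : ℝ}

/-- Slice bound for `|V|²` under the apex envelope: `‖V(t,x)‖² ≤ C² ‖x‖⁻²` (`x ≠ 0`). [folklore] -/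
theorem enorm_sq_le_of_envelope (hV : HasTypeIDecay C V) {t : ℝ} (ht : t < 0) {x : (EuclideanSpace ℝ (Fin 3))}
    (hx : x ≠ 0) :
    ‖V t x‖ₑ ^ 2 ≤ ENNReal.ofReal (C ^ 2) * ENNReal.ofReal (‖x‖ ^ (-(2 : ℝ))) := by
  have hC : 0 ≤ C := nonneg_of_hasTypeIDecay hV
  have ha : 0 < ‖x‖ := norm_pos_iff.2 hx
  have hb : 0 < Real.sqrt (-t) := Real.sqrt_pos.2 (by linarith)
  set w : ℝ := ‖x‖ + Real.sqrt (-t) with hw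
  have hw0 : 0 < w := by positivity
  have h1 : ‖V t x‖ ^ 2 ≤ C ^ 2 / w ^ ((2 : ℝ) + 0) := by
    rw [add_zero, show w ^ (2 : ℝ) = w ^ (2 : ℕ) by exact_mod_cast Real.rpow_natCast w 2,
      ← div_pow]
    exact pow_le_pow_left₀ (norm_nonneg _) (hV t ht x) 2
  have h2 := div_rpow_add_le (K := C ^ 2) ha hb (le_add_of_nonneg_right hb.le)
    (le_add_of_nonneg_left ha.le) (by norm_num : (0 : ℝ) ≤ 2) le_rfl (sq_nonneg C)
  rw [neg_zero, Real.rpow_zero, mul_one] at h2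
  rw [← ofReal_norm, ← ENNReal.ofReal_pow (norm_nonneg _),
    ← ENNReal.ofReal_mul (sq_nonneg C)]
  exact ENNReal.ofReal_le_ofReal (h1.trans h2)

/-- Slice bound for `|V|³`: `‖V(t,x)‖³ ≤ C³ (−t)^{−1/2} ‖x‖⁻²` (`x ≠ 0`). [folklore] -/
theorem enorm_cube_le_of_envelope (hV : HasTypeIDecay C V) {t : ℝ} (ht : t < 0) {x : (EuclideanSpace ℝ (Fin 3))}
    (hx : x ≠ 0) :
    ‖V t x‖ₑ ^ (3 : ℕ) ≤
      ENNReal.ofReal (C ^ 3 * (-t) ^ (-(1 / 2 : ℝ))) * ENNReal.ofReal (‖x‖ ^ (-(2 : ℝ))) := by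
  have hC : 0 ≤ C := nonneg_of_hasTypeIDecay hV
  have ha : 0 < ‖x‖ := norm_pos_iff.2 hx
  have hb : 0 < Real.sqrt (-t) := Real.sqrt_pos.2 (by linarith)
  set w : ℝ := ‖x‖ + Real.sqrt (-t) with hw
  have hw0 : 0 < w := by positivity
  have h1 : ‖V t x‖ ^ 3 ≤ C ^ 3 / w ^ ((2 : ℝ) + 1) := by
    rw [show (2 : ℝ) + 1 = ((3 : ℕ) : ℝ) by norm_num, Real.rpow_natCast, ← div_pow]
    exact pow_le_pow_left₀ (norm_nonneg _) (hV t ht x) 3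
  have h2 := div_rpow_add_le (K := C ^ 3) ha hb (le_add_of_nonneg_right hb.le)
    (le_add_of_nonneg_left ha.le) (by norm_num : (0 : ℝ) ≤ 2) zero_le_one (pow_nonneg hC 3)
  rw [sqrt_neg_rpow_neg ht] at h2
  rw [← ofReal_norm, ← ENNReal.ofReal_pow (norm_nonneg _),
    ← ENNReal.ofReal_mul (mul_nonneg (pow_nonneg hC 3) (Real.rpow_nonneg (by linarith) _))]
  refine ENNReal.ofReal_le_ofReal (h1.trans (h2.trans (le_of_eq ?_)))
  ring

/-- Slice bound for the pressure: `|Q(t,x)|^{3/2} ≤ L^{3/2} (−t)^{−1/2} ‖x‖⁻²` (`x ≠ 0`) under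
`|Q| ≤ L/w²`. [folklore] -/
theorem enorm_rpow_le_of_envelope (hQ : ∀ t < 0, ∀ x, |Q t x| ≤ L / (‖x‖ + Real.sqrt (-t)) ^ 2)
    (hL : 0 ≤ L) {t : ℝ} (ht : t < 0) {x : (EuclideanSpace ℝ (Fin 3))} (hx : x ≠ 0) :
    ‖Q t x‖ₑ ^ (3 / 2 : ℝ) ≤
      ENNReal.ofReal (L ^ (3 / 2 : ℝ) * (-t) ^ (-(1 / 2 : ℝ))) *
        ENNReal.ofReal (‖x‖ ^ (-(2 : ℝ))) := by
  have ha : 0 < ‖x‖ := norm_pos_iff.2 hx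
  have hb : 0 < Real.sqrt (-t) := Real.sqrt_pos.2 (by linarith)
  set w : ℝ := ‖x‖ + Real.sqrt (-t) with hw
  have hw0 : 0 < w := by positivity
  have h1 : |Q t x| ^ (3 / 2 : ℝ) ≤ L ^ (3 / 2 : ℝ) / w ^ ((2 : ℝ) + 1) := by
    have h := Real.rpow_le_rpow (abs_nonneg _) (hQ t ht x) (by norm_num : (0 : ℝ) ≤ 3 / 2)
    rw [Real.div_rpow hL (sq_nonneg w), show w ^ 2 = w ^ (2 : ℝ) by
      exact_mod_cast (Real.rpow_natCast w 2).symm, ← Real.rpow_mul hw0.le] at h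
    convert h using 2
    norm_num
  have h2 := div_rpow_add_le (K := L ^ (3 / 2 : ℝ)) ha hb (le_add_of_nonneg_right hb.le)
    (le_add_of_nonneg_left ha.le) (by norm_num : (0 : ℝ) ≤ 2) zero_le_one (Real.rpow_nonneg hL _)
  rw [sqrt_neg_rpow_neg ht] at h2
  rw [Real.enorm_eq_ofReal_abs, ENNReal.ofReal_rpow_of_nonneg (abs_nonneg _) (by norm_num),
    ← ENNReal.ofReal_mul (mul_nonneg (Real.rpow_nonneg hL _) (Real.rpow_nonneg (by linarith) _))]
  refine ENNReal.ofReal_le_ofReal (h1.trans (h2.trans (le_of_eq ?_)))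
  ring

/-- Slice bound for the gradient: `|G(t,x)|²_F ≤ 3 L² (−t)^{−3/4} ‖x‖^{−5/2}` (`x ≠ 0`) under
`‖G‖ ≤ L/w²` (`|·|²_F ≤ 3 ‖·‖²_op`). [folklore] -/
theorem ofReal_frob_le_of_envelope
    (hG : ∀ t < 0, ∀ x, ‖G t x‖ ≤ L / (‖x‖ + Real.sqrt (-t)) ^ 2) {t : ℝ}
    (ht : t < 0) {x : (EuclideanSpace ℝ (Fin 3))} (hx : x ≠ 0) :
    ENNReal.ofReal (frobeniusNormSq (G t x)) ≤
      ENNReal.ofReal (3 * L ^ 2 * (-t) ^ (-(3 / 4 : ℝ))) *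
        ENNReal.ofReal (‖x‖ ^ (-(5 / 2 : ℝ))) := by
  have ha : 0 < ‖x‖ := norm_pos_iff.2 hx
  have hb : 0 < Real.sqrt (-t) := Real.sqrt_pos.2 (by linarith)
  set w : ℝ := ‖x‖ + Real.sqrt (-t) with hw
  have hw0 : 0 < w := by positivity
  have h1 : frobeniusNormSq (G t x) ≤ 3 * L ^ 2 / w ^ ((5 / 2 : ℝ) + 3 / 2) := by
    have hf := frobeniusNormSq_le_three_mul_norm_sq' (G t x)
    have hg : ‖G t x‖ ^ 2 ≤ (L / w ^ 2) ^ 2 := pow_le_pow_left₀ (norm_nonneg _) (hG t ht x) 2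
    rw [show (5 / 2 : ℝ) + 3 / 2 = ((4 : ℕ) : ℝ) by norm_num, Real.rpow_natCast]
    calc frobeniusNormSq (G t x) ≤ 3 * ‖G t x‖ ^ 2 := hf
      _ ≤ 3 * (L / w ^ 2) ^ 2 := by gcongr
      _ = 3 * L ^ 2 / w ^ 4 := by rw [div_pow]; ring
  have h2 := div_rpow_add_le (K := 3 * L ^ 2) ha hb (le_add_of_nonneg_right hb.le)
    (le_add_of_nonneg_left ha.le) (by norm_num : (0 : ℝ) ≤ 5 / 2) (by norm_num : (0 : ℝ) ≤ 3 / 2)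
    (by positivity)
  rw [sqrt_neg_rpow_neg ht] at h2
  rw [← ENNReal.ofReal_mul (mul_nonneg (by positivity) (Real.rpow_nonneg (by linarith) _))]
  refine ENNReal.ofReal_le_ofReal (h1.trans (h2.trans (le_of_eq ?_)))
  norm_num
  ring

/-! ### Slice integrals over balls -/

/-- Almost every point of a ball (indeed of `ℝ³`) is non-zero. [folklore] -/
theorem ae_ne_zero_ball (x₀ : (EuclideanSpace ℝ (Fin 3))) (r : ℝ) :
    ∀ᵐ x ∂(volume.restrict (ball x₀ r)), x ≠ (0 : (EuclideanSpace ℝ (Fin 3))) := by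
  refine ae_restrict_of_ae ?_
  rw [ae_iff]
  simp only [ne_eq, not_not, setOf_eq_eq_singleton, measure_singleton]

/-- The radial bound at exponent `2`: `∫_{B(x₀,r)} ‖x‖⁻² ≤ M₂ r`. [folklore] -/
theorem exists_ball_rpow_two_bound :
    ∃ M : ℝ, 0 ≤ M ∧ ∀ (x₀ : (EuclideanSpace ℝ (Fin 3))) (r : ℝ), 0 < r →
      ∫⁻ x in ball x₀ r, ENNReal.ofReal (‖x‖ ^ (-(2 : ℝ))) ≤ ENNReal.ofReal (M * r) := by
  refine ⟨_, ballConst_nonneg (σ := 2) (by norm_num), fun x₀ r hr => ?_⟩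
  have h := lintegral_ball_norm_rpow_neg_le (σ := 2) (by norm_num) (by norm_num) x₀ hr
  have e : r ^ ((3 : ℝ) - 2) = r := by norm_num
  rwa [e] at h

/-- The radial bound at exponent `5/2`: `∫_{B(x₀,r)} ‖x‖^{−5/2} ≤ M_{5/2} r^{1/2}`. [folklore] -/
theorem exists_ball_rpow_fiveHalves_bound :
    ∃ M : ℝ, 0 ≤ M ∧ ∀ (x₀ : (EuclideanSpace ℝ (Fin 3))) (r : ℝ), 0 < r →
      ∫⁻ x in ball x₀ r, ENNReal.ofReal (‖x‖ ^ (-(5 / 2 : ℝ))) ≤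
        ENNReal.ofReal (M * r ^ (1 / 2 : ℝ)) := by
  refine ⟨_, ballConst_nonneg (σ := 5 / 2) (by norm_num), fun x₀ r hr => ?_⟩
  have h := lintegral_ball_norm_rpow_neg_le (σ := 5 / 2) (by norm_num) (by norm_num) x₀ hr
  have e : r ^ ((3 : ℝ) - 5 / 2) = r ^ (1 / 2 : ℝ) := by norm_num
  rwa [e] at h

end Summit.NavierStokesRegularity.NavierStokesRegularity.Theorems.NoApexEnvelope

end
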